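import Summits.ValiantsHypothesis.ValiantsHypothesis.Theorems.KPlusLogSqLawDefinitePivotUnfolding
import Summits.ValiantsHypothesis.ValiantsHypothesis.Theorems.LacunarySymmetroidMatrixDescartesFirstRung

/-!
# Route «KPlusLogSqLaw», crux `WeakLifting` (stmt-ValiantsHypothesis-19561) — α register / Lift line:
# THIN rank unfolding (size `∑ₖ rank`) and the FIRST RUNG OF THE RANK LAW (one-sided definite pivot)

HONEST FRAMING.  Helper file (`--supports stmt-ValiantsHypothesis-19561 --as helper`), seat val-sym-lift-p2 (g12), cell `pub-symmetroid`,
2026-08-28; companion of `…KPlusLogSqLawDefinitePivotUnfolding` (p602364, square unfolding of size `m·K`).  Linear algebra only; nothing here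
bears on `WeakLifting`, `TropicalB`, Conjecture B, Door-A, `MatrixDescartes` (stmt-ValiantsHypothesis-18050) or VP ≠ VNP.

WHAT IS PROVED.  Letters in FACTORED form `Pₖ = Mₖ Mₖᵀ` with `Mₖ : m × rₖ` (so `rank Pₖ ≤ rₖ`; every PSD matrix of rank `r` has such a
factor), an invertible pivot letter `N` (`N N' = 1`), exponents `cₖ + dₖ = D + e`.
* `det_eq_zero_iff_det_thinUnfold_eq_zero`, `posRoots_pencil_eq_posRoots_thinUnfold` — the pencil `∑ₖ X^{dₖ} MₖMₖᵀ − X^e N` and its THIN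
  unfolding `∑ₖ X^{cₖ} Eₖ − X^D (Vᵀ N' V)` on the index type `Σ k, Fin rₖ` (size `∑ₖ rₖ`; `V i ⟨k,j⟩ = Mₖ i j`, `Eₖ` the block projector) have the
  same positive roots of their determinants (Sylvester, exactly as in the square file).
* (used) the Lift line's FIRST RUNG as landed in the tree, `…LacunarySymmetroidMatrixDescartes.firstRung_low/high`
  (`Theorems/LacunarySymmetroidMatrixDescartesFirstRung.lean`): `X^e J + ∑ X^{dₖ} Pₖ` with `J` symmetric, `Pₖ ⪰ 0` and `e` EXTREME has at
  most `card ι` positive roots.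
* **`posRoots_le_sum_rank_of_high` / `…_of_low` — FIRST RUNG OF THE RANK LAW:** for `N ≻ 0` and the pivot exponent `e` at least (resp. at most)
  every `dₖ`, the definite-pivot pencil `∑ₖ X^{dₖ} MₖMₖᵀ − X^e N` has at most `∑ₖ rₖ` distinct positive roots of its determinant — the bound of
  the lineage's conjecture R0 / the rank law (memo RANK-LAW-liftp2g12.md) in the one-sided configuration, sharper than the first rung's `m`
  whenever `∑ rank Pₖ < m`.  Mechanism: unfold thinly (the pivot `−VᵀN⁻¹V` becomes the extreme letter of a PSD-diagonal pencil of size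
  `∑ rₖ`), then apply the first rung at that size.  The two-sided configuration (the rank law proper) is OPEN.

[folklore] Sylvester's determinant identity; Loewner monotonicity (the tree's inertia chain).
-/

-- `Summit.ValiantsHypothesis.ValiantsHypothesis.…` repeats a component by the D-0017 layout
-- (single-conjunct summit), which the `dupNamespace` linter flags; the name is mandated.
set_option linter.dupNamespace false
set_option autoImplicit false

namespace Summit.ValiantsHypothesis.ValiantsHypothesis.Theorems.KPlusLogSqLaw.DefinitePivot

open Matrix Polynomial Finset
open scoped BigOperators
open Summit.ValiantsHypothesis.ValiantsHypothesis.Theorems.LacunarySymmetroidMatrixDescartes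
  (firstRung_low firstRung_high)

/-! ## 1. Thin unfolding on `Σ k, Fin rₖ` -/

section Thin

variable {m K : ℕ} {r : Fin K → ℕ}

/-- stacking thin Gram factors: `∑ₖ wₖ • MₖMₖᵀ = V · diag(w) · Vᵀ`, `V i ⟨k, j⟩ = Mₖ i j`. [folklore] -/
theorem sum_smul_mul_transpose_eq_thin (M : (k : Fin K) → Matrix (Fin m) (Fin (r k)) ℝ) (w : Fin K → ℝ) :
    (∑ k, w k • (M k * (M k)ᵀ)) =
      (Matrix.of fun (i : Fin m) (jk : Σ k : Fin K, Fin (r k)) => M jk.1 i jk.2) *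
        Matrix.diagonal (fun jk : Σ k : Fin K, Fin (r k) => w jk.1) *
        (Matrix.of fun (i : Fin m) (jk : Σ k : Fin K, Fin (r k)) => M jk.1 i jk.2)ᵀ := by
  ext i j
  rw [Matrix.mul_apply]
  simp only [Matrix.mul_diagonal]
  simp only [Matrix.of_apply, Matrix.transpose_apply, Matrix.sum_apply, Matrix.smul_apply, smul_eq_mul,
    Matrix.mul_apply]
  rw [Fintype.sum_sigma]
  refine Finset.sum_congr rfl fun k _ => ?_
  rw [Finset.mul_sum]
  refine Finset.sum_congr rfl fun a _ => ?_
  ring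

/-- the thin block projectors with weights sum to a diagonal matrix. [folklore] -/
theorem sum_smul_thinBlockProj_eq_diagonal (w : Fin K → ℝ) :
    (∑ k, w k • Matrix.diagonal (fun jk : Σ k : Fin K, Fin (r k) => if jk.1 = k then (1 : ℝ) else 0)) =
      Matrix.diagonal (fun jk : Σ k : Fin K, Fin (r k) => w jk.1) := by
  ext a b
  simp only [Matrix.sum_apply, Matrix.smul_apply, Matrix.diagonal_apply, smul_eq_mul, mul_ite, mul_one, mul_zero]
  by_cases hab : a = b
  · simp only [hab, if_true]
    rw [Finset.sum_ite_eq]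
    simp
  · simp [hab]

/-- **THIN UNFOLDING AT A POINT**: for `x > 0`, `det(∑ₖ x^{dₖ} MₖMₖᵀ − x^e N) = 0 ↔ det(∑ₖ x^{cₖ} Eₖ − x^D VᵀN'V) = 0` on the index type
`Σ k, Fin rₖ` (`N N' = 1`, `cₖ + dₖ = D + e`). [folklore] -/
theorem det_eq_zero_iff_det_thinUnfold_eq_zero (M : (k : Fin K) → Matrix (Fin m) (Fin (r k)) ℝ)
    (N N' : Matrix (Fin m) (Fin m) ℝ) (hN : N * N' = 1) (d c : Fin K → ℕ) (e D : ℕ)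
    (hc : ∀ k, c k + d k = D + e) {x : ℝ} (hx : 0 < x) :
    (∑ k, x ^ d k • (M k * (M k)ᵀ) - x ^ e • N).det = 0 ↔
      (∑ k, x ^ c k • Matrix.diagonal (fun jk : Σ k : Fin K, Fin (r k) => if jk.1 = k then (1 : ℝ) else 0) -
        x ^ D • ((Matrix.of fun (i : Fin m) (jk : Σ k : Fin K, Fin (r k)) => M jk.1 i jk.2)ᵀ * N' *
          (Matrix.of fun (i : Fin m) (jk : Σ k : Fin K, Fin (r k)) => M jk.1 i jk.2))).det = 0 := by
  set V : Matrix (Fin m) (Σ k : Fin K, Fin (r k)) ℝ :=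
    Matrix.of fun (i : Fin m) (jk : Σ k : Fin K, Fin (r k)) => M jk.1 i jk.2 with hV
  set E : Matrix (Σ k : Fin K, Fin (r k)) (Σ k : Fin K, Fin (r k)) ℝ :=
    Matrix.diagonal (fun jk : Σ k : Fin K, Fin (r k) => x ^ d jk.1) with hE
  have hxe : x ^ e ≠ 0 := pow_ne_zero _ hx.ne'
  have hxD : x ^ D ≠ 0 := pow_ne_zero _ hx.ne'
  have hF : (∑ k, x ^ d k • (M k * (M k)ᵀ) - x ^ e • N) =
      -(N * (x ^ e • (1 : Matrix (Fin m) (Fin m) ℝ) - (N' * V) * (E * Vᵀ))) := by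
    rw [sum_smul_mul_transpose_eq_thin M (fun k => x ^ d k), ← hV, ← hE, Matrix.mul_sub, Matrix.mul_smul, Matrix.mul_one,
      ← Matrix.mul_assoc, ← Matrix.mul_assoc, ← Matrix.mul_assoc, hN, Matrix.one_mul, neg_sub, Matrix.mul_assoc]
  have hEsum : E * (∑ k, x ^ c k • Matrix.diagonal (fun jk : Σ k : Fin K, Fin (r k) => if jk.1 = k then (1 : ℝ) else 0)) =
      x ^ D • (x ^ e • (1 : Matrix (Σ k : Fin K, Fin (r k)) (Σ k : Fin K, Fin (r k)) ℝ)) := by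
    rw [sum_smul_thinBlockProj_eq_diagonal, hE, Matrix.diagonal_mul_diagonal, smul_smul, ← Matrix.diagonal_one,
      ← Matrix.diagonal_smul]
    congr 1
    funext jk
    simp only [Pi.smul_apply, smul_eq_mul, mul_one]
    rw [← pow_add, ← pow_add, add_comm (d jk.1), hc jk.1]
  have hEG : E * (∑ k, x ^ c k • Matrix.diagonal (fun jk : Σ k : Fin K, Fin (r k) => if jk.1 = k then (1 : ℝ) else 0) -
      x ^ D • (Vᵀ * N' * V)) = x ^ D • (x ^ e • (1 : Matrix _ _ ℝ) - (E * Vᵀ) * (N' * V)) := by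
    rw [Matrix.mul_sub, hEsum, Matrix.mul_smul, smul_sub]
    simp only [Matrix.mul_assoc]
  have hdetE : E.det ≠ 0 := by
    rw [hE, Matrix.det_diagonal]
    exact Finset.prod_ne_zero_iff.2 fun jk _ => pow_ne_zero _ hx.ne'
  rw [hF, Matrix.det_neg, Matrix.det_mul]
  have hNdet : N.det ≠ 0 := by
    have h := congrArg Matrix.det hN
    rw [Matrix.det_mul, Matrix.det_one] at h
    exact left_ne_zero_of_mul_eq_one h
  rw [mul_eq_zero, mul_eq_zero, or_iff_right (pow_ne_zero _ (by norm_num : (-1 : ℝ) ≠ 0)), or_iff_right hNdet,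
    det_smul_one_sub_mul_eq_zero_iff (N' * V) (E * Vᵀ) hxe]
  have key : E.det * (∑ k, x ^ c k • Matrix.diagonal (fun jk : Σ k : Fin K, Fin (r k) => if jk.1 = k then (1 : ℝ) else 0) -
      x ^ D • (Vᵀ * N' * V)).det = (x ^ D) ^ Fintype.card (Σ k : Fin K, Fin (r k)) *
        (x ^ e • (1 : Matrix _ _ ℝ) - (E * Vᵀ) * (N' * V)).det := by
    rw [← Matrix.det_mul, hEG, Matrix.det_smul]
  constructor
  · intro h
    have h2 : E.det * (∑ k, x ^ c k • Matrix.diagonal (fun jk : Σ k : Fin K, Fin (r k) => if jk.1 = k then (1 : ℝ) else 0) -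
        x ^ D • (Vᵀ * N' * V)).det = 0 := by
      rw [key, h, mul_zero]
    rcases mul_eq_zero.1 h2 with h3 | h3
    · exact absurd h3 hdetE
    · exact h3
  · intro h
    have h2 : (x ^ D) ^ Fintype.card (Σ k : Fin K, Fin (r k)) *
        (x ^ e • (1 : Matrix _ _ ℝ) - (E * Vᵀ) * (N' * V)).det = 0 := by
      rw [← key, h, mul_zero]
    rcases mul_eq_zero.1 h2 with h3 | h3
    · exact absurd h3 (pow_ne_zero _ hxD)
    · exact h3

/-- **THIN UNFOLDING IN CENSUS CURRENCY**: same positive-root finsets. [folklore] -/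
theorem posRoots_pencil_eq_posRoots_thinUnfold (M : (k : Fin K) → Matrix (Fin m) (Fin (r k)) ℝ)
    (N N' : Matrix (Fin m) (Fin m) ℝ) (hN : N * N' = 1) (d c : Fin K → ℕ) (e D : ℕ)
    (hc : ∀ k, c k + d k = D + e) :
    ((∑ k, (X : ℝ[X]) ^ d k • (M k * (M k)ᵀ).map C - (X : ℝ[X]) ^ e • N.map C).det.roots.toFinset.filter
        (fun t => 0 < t)) =
      ((∑ k, (X : ℝ[X]) ^ c k •
            (Matrix.diagonal (fun jk : Σ k : Fin K, Fin (r k) => if jk.1 = k then (1 : ℝ) else 0)).map C -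
          (X : ℝ[X]) ^ D • (((Matrix.of fun (i : Fin m) (jk : Σ k : Fin K, Fin (r k)) => M jk.1 i jk.2)ᵀ * N' *
            (Matrix.of fun (i : Fin m) (jk : Σ k : Fin K, Fin (r k)) => M jk.1 i jk.2))).map C).det.roots.toFinset.filter
        (fun t => 0 < t)) := by
  refine posRoots_eq_of_forall_eval_eq_zero_iff _ _ fun x hx => ?_
  rw [eval_det_pencil_sub, eval_det_pencil_sub]
  exact det_eq_zero_iff_det_thinUnfold_eq_zero M N N' hN d c e D hc hx

end Thin

/-! ## 2. First rung of the RANK LAW: one-sided definite pivot ⇒ `Z₊ ≤ ∑ₖ rₖ` -/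

section RankLaw

variable {m K : ℕ} {r : Fin K → ℕ}

/-- the thin block projector is positive semidefinite. [folklore] -/
theorem posSemidef_thinBlockProj (k : Fin K) :
    (Matrix.diagonal (fun jk : Σ k : Fin K, Fin (r k) => if jk.1 = k then (1 : ℝ) else 0)).PosSemidef :=
  Matrix.PosSemidef.diagonal (fun jk => by
    show (0 : ℝ) ≤ if jk.1 = k then 1 else 0
    split_ifs <;> norm_num)

/-- rewriting the unfolded pencil in the Lift line's shape `X^D • J + ∑ X^{cₖ} • Eₖ` with `J = −C′`. [folklore] -/
theorem thinUnfold_eq_liftShape (c : Fin K → ℕ) (D : ℕ) (C' : Matrix (Σ k : Fin K, Fin (r k)) (Σ k : Fin K, Fin (r k)) ℝ) :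
    (∑ k, (X : ℝ[X]) ^ c k •
          (Matrix.diagonal (fun jk : Σ k : Fin K, Fin (r k) => if jk.1 = k then (1 : ℝ) else 0)).map C -
        (X : ℝ[X]) ^ D • C'.map C) =
      (X : ℝ[X]) ^ D • (-C').map C +
        ∑ k, (X : ℝ[X]) ^ c k •
          (Matrix.diagonal (fun jk : Σ k : Fin K, Fin (r k) => if jk.1 = k then (1 : ℝ) else 0)).map C := by
  rw [sub_eq_add_neg, add_comm, ← smul_neg]
  congr 2
  ext i j
  simp

/-- **FIRST RUNG OF THE RANK LAW (pivot on top).**  `N ≻ 0`, `dₖ ≤ e` for all `k`: the definite-pivot pencil `∑ₖ X^{dₖ} MₖMₖᵀ − X^e N`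
(`Mₖ : m × rₖ`) has at most `∑ₖ rₖ` distinct positive roots of its determinant. [folklore] -/
theorem posRoots_le_sum_rank_of_high (M : (k : Fin K) → Matrix (Fin m) (Fin (r k)) ℝ)
    (N : Matrix (Fin m) (Fin m) ℝ) (hN : N.PosDef) (d : Fin K → ℕ) (e : ℕ) (hd : ∀ k, d k ≤ e) :
    ((∑ k, (X : ℝ[X]) ^ d k • (M k * (M k)ᵀ).map C - (X : ℝ[X]) ^ e • N.map C).det.roots.toFinset.filter
        (fun t => 0 < t)).card ≤ ∑ k, r k := by
  classical
  have hNunit : IsUnit N.det := isUnit_iff_ne_zero.2 hN.det_pos.ne'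
  have hNN : N * N⁻¹ = 1 := Matrix.mul_nonsing_inv N hNunit
  -- exponents: c k := e - d k, D := 0 (so c k + d k = 0 + e)
  rw [posRoots_pencil_eq_posRoots_thinUnfold M N N⁻¹ hNN d (fun k => e - d k) e 0 (fun k => by
    have := hd k; omega)]
  set V : Matrix (Fin m) (Σ k : Fin K, Fin (r k)) ℝ :=
    Matrix.of fun (i : Fin m) (jk : Σ k : Fin K, Fin (r k)) => M jk.1 i jk.2 with hV
  rw [thinUnfold_eq_liftShape]
  have hC's : (-(Vᵀ * N⁻¹ * V)).IsSymm := by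
    have h1 : (Vᵀ * N⁻¹ * V).IsSymm := by
      unfold Matrix.IsSymm
      rw [Matrix.transpose_mul, Matrix.transpose_mul, Matrix.transpose_transpose, ← Matrix.mul_assoc]
      congr 1
      rw [Matrix.transpose_nonsing_inv, (Matrix.isHermitian_iff_isSymm.1 hN.1).eq]
    exact h1.neg
  calc _ ≤ Fintype.card (Σ k : Fin K, Fin (r k)) :=
        firstRung_low (Σ k : Fin K, Fin (r k)) (Fin K) 0 (fun k => e - d k) (-(Vᵀ * N⁻¹ * V))
          (fun k => Matrix.diagonal (fun jk : Σ k : Fin K, Fin (r k) => if jk.1 = k then (1 : ℝ) else 0))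
          hC's (fun k => posSemidef_thinBlockProj k) (fun k => Nat.zero_le _)
    _ = ∑ k, r k := by simp [Fintype.card_sigma]

/-- **FIRST RUNG OF THE RANK LAW (pivot at the bottom).**  `N ≻ 0`, `e ≤ dₖ` for all `k`: at most `∑ₖ rₖ` positive roots. [folklore] -/
theorem posRoots_le_sum_rank_of_low (M : (k : Fin K) → Matrix (Fin m) (Fin (r k)) ℝ)
    (N : Matrix (Fin m) (Fin m) ℝ) (hN : N.PosDef) (d : Fin K → ℕ) (e : ℕ) (hd : ∀ k, e ≤ d k)
    (Dm : ℕ) (hDm : ∀ k, d k ≤ Dm) :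
    ((∑ k, (X : ℝ[X]) ^ d k • (M k * (M k)ᵀ).map C - (X : ℝ[X]) ^ e • N.map C).det.roots.toFinset.filter
        (fun t => 0 < t)).card ≤ ∑ k, r k := by
  classical
  have hNunit : IsUnit N.det := isUnit_iff_ne_zero.2 hN.det_pos.ne'
  have hNN : N * N⁻¹ = 1 := Matrix.mul_nonsing_inv N hNunit
  -- exponents: D := Dm - e, c k := Dm - d k (so c k + d k = D + e), and c k ≤ D
  rw [posRoots_pencil_eq_posRoots_thinUnfold M N N⁻¹ hNN d (fun k => Dm - d k) e (Dm - e) (fun k => by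
    have := hd k; have := hDm k; omega)]
  set V : Matrix (Fin m) (Σ k : Fin K, Fin (r k)) ℝ :=
    Matrix.of fun (i : Fin m) (jk : Σ k : Fin K, Fin (r k)) => M jk.1 i jk.2 with hV
  rw [thinUnfold_eq_liftShape]
  have hC's : (-(Vᵀ * N⁻¹ * V)).IsSymm := by
    have h1 : (Vᵀ * N⁻¹ * V).IsSymm := by
      unfold Matrix.IsSymm
      rw [Matrix.transpose_mul, Matrix.transpose_mul, Matrix.transpose_transpose, ← Matrix.mul_assoc]
      congr 1
      rw [Matrix.transpose_nonsing_inv, (Matrix.isHermitian_iff_isSymm.1 hN.1).eq]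
    exact h1.neg
  calc _ ≤ Fintype.card (Σ k : Fin K, Fin (r k)) :=
        firstRung_high (Σ k : Fin K, Fin (r k)) (Fin K) (Dm - e) (fun k => Dm - d k) (-(Vᵀ * N⁻¹ * V))
          (fun k => Matrix.diagonal (fun jk : Σ k : Fin K, Fin (r k) => if jk.1 = k then (1 : ℝ) else 0))
          hC's (fun k => posSemidef_thinBlockProj k) (fun k => by have := hd k; have := hDm k; omega)
    _ = ∑ k, r k := by simp [Fintype.card_sigma]

end RankLaw

end Summit.ValiantsHypothesis.ValiantsHypothesis.Theorems.KPlusLogSqLaw.DefinitePivot
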